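import Literature.NumberTheory.IwasawaTheory.ClassicalMuVanishesNormRelationTower
import HarnessLib

set_option autoImplicit false

/-!
# The layer `L·F_n / F` of a restricted `ℤ_p`-tower: a section `s : Gal(L/F) ↪ Gal(L·F_n/F)` whose fixed fields are the
# layers of the sub-towers, `(L·F_n)^{s(H)} = L^H·F_n ≅ (L^H·F_∞)_n`

Topic `NumberTheory/IwasawaTheory` (namespace = path).  THEOREM-ONLY file (no definition, no named fact, no `sorry`), written by
the literature seat `bsd-potss-conjA-anchor` g11 (cell `bsd-potss`; supports stmt-BirchSwinnertonDyer-19386 / 19413; closes nothing).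
It EXPOSES, as a reusable statement, the Galois-theoretic core of the proof of
`classNumberPExp_restrict_le_sum_of_normRelation` (`ClassicalMuVanishesNormRelationTower.lean`): for a number field `F`, a
`ℤ_p`-extension `κ` of `F` (layers `F_n ⊆ F̄`), a finite Galois `L/F` with `κ ∘ res` onto (`L ∩ F_∞ = F`), `e = absEmbedding F L`
and `L_n := e(L) ⊔ F_n ⊆ F̄` (a finite Galois extension of `F`, `isGalois_fieldRange_sup_layer`; ring-isomorphic to the `n`-th layer
of `κ|_L`, `ZpExtension.natCard_classGroup_layer_restrict_eq`):

* `exists_section_fixedField_map_eq` — there is an injective homomorphism `s : Gal(L/F) → Gal(L_n/F)` («the lift acting trivially on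
  `F_n`»; so `Gal(L_n/F) ≅ Gal(L/F) × Gal(F_n/F)`, Washington §13.1) such that for EVERY subgroup `H ≤ Gal(L/F)` the fixed field of
  `s(H)` in `L_n` is `e(L^H) ⊔ F_n` (as subfields of `F̄`), hence is ring-isomorphic to the `n`-th layer of `κ|_{L^H}` and has the same
  class number: `#Cl(L_n^{s(H)}) = #Cl((L^H·F_∞)_n)`.

With it, ANY identity or inequality between class numbers of intermediate fields of a Galois extension with group `G` that is
natural in `G` (norm relations — `NormRelation.padicValNat_card_classGroup_le_sum_of_normRelation`; Kuroda's formula —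
`KurodaOddPart.card_torsion_classGroup_dihedral`; …) transfers from `L/F` to every layer `L_n/F` and becomes a relation between the
exponents `e_n` of the towers `L^H·F_∞` (`classNumberPExp`).  This file is used by `ClassicalMuVanishesKurodaTower.lean` (growth-fact-free
μ-descent through Kuroda's relation).

References: [Washington1997] §13.1 (`K_∞L/L`, `Gal(LK_n/K) ≅ Gal(L/K) × Gal(K_n/K)` when `L ∩ K_∞ = K`); [MilneFT2022] Ch. 3, Ch. 7.
-/

noncomputable section

open scoped NumberField

open Field IntermediateField Literature.NumberTheory.GaloisRepresentations Literature.NumberTheory.EllipticCurves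
  Literature.NumberTheory.EllipticCurves.ZpExtension

namespace Literature.NumberTheory.IwasawaTheory

/-- Section lemma: if `q : G → A` is onto on a subgroup `K` and `q`, `r : G → B` have the same kernel on `K`, then there is an
injective `s : A → B` with `s (q k) = r k` for `k ∈ K`. [folklore] -/
private theorem exists_monoidHom_comp_eq' {G A B : Type*} [Group G] [Group A] [Group B]
    (K : Subgroup G) (q : G →* A) (r : G →* B)
    (hq : ∀ a : A, ∃ k ∈ K, q k = a) (hker : ∀ k ∈ K, q k = 1 ↔ r k = 1) :
    ∃ s : A →* B, Function.Injective s ∧ ∀ k ∈ K, s (q k) = r k := by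
  set qK : K →* A := q.comp K.subtype with hqK_def
  set rK : K →* B := r.comp K.subtype with hrK_def
  have hqK : Function.Surjective qK := fun a => by
    obtain ⟨k, hk, e⟩ := hq a
    exact ⟨⟨k, hk⟩, e⟩
  have hkers : qK.ker = rK.ker := by
    ext ⟨k, hk⟩
    rw [MonoidHom.mem_ker, MonoidHom.mem_ker]
    exact hker k hk
  let e1 : K ⧸ qK.ker ≃* A := QuotientGroup.quotientKerEquivOfSurjective qK hqK
  let e2 : K ⧸ qK.ker ≃* K ⧸ rK.ker := QuotientGroup.quotientMulEquivOfEq hkers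
  refine ⟨(QuotientGroup.kerLift rK).comp (e2.toMonoidHom.comp e1.symm.toMonoidHom),
    (QuotientGroup.kerLift_injective rK).comp (e2.injective.comp e1.symm.injective), fun k hk => ?_⟩
  have h1 : e1.symm (q k) = (QuotientGroup.mk ⟨k, hk⟩ : K ⧸ qK.ker) := by
    rw [MulEquiv.symm_apply_eq]
    rfl
  show QuotientGroup.kerLift rK (e2 (e1.symm (q k))) = r k
  rw [h1, QuotientGroup.quotientMulEquivOfEq_mk, QuotientGroup.kerLift_mk]
  rfl

variable {F : Type} [Field F] [NumberField F] {p : ℕ} [Fact p.Prime]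

omit [NumberField F] in
/-- `Gal(F̄/e(L^H)) = {τ : τ̄ ∈ H}` (`e = absEmbedding F L`, `τ̄ = absGaloisQuot τ`). [cite: Washington1997, §13.1] -/
private theorem map_comap_absGaloisQuot_eq_fixingSubgroup' (L : Type) [Field L] [Algebra F L] [IsGalois F L]
    [FiniteDimensional F L] (H : Subgroup (L ≃ₐ[F] L)) :
    (H.comap (absGaloisQuot F L)).map (absoluteGaloisGroup.toAlgEquiv F).toMonoidHom =
      (IntermediateField.map (absEmbedding F L) (fixedField H)).fixingSubgroup := by
  ext g
  rw [Subgroup.mem_map_equiv, Subgroup.mem_comap, IntermediateField.mem_fixingSubgroup_iff,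
    ← IntermediateField.fixingSubgroup_fixedField H, IntermediateField.mem_fixingSubgroup_iff,
    IntermediateField.fixingSubgroup_fixedField H]
  constructor
  · rintro h y ⟨x, hx, rfl⟩
    have := absEmbedding_absGaloisQuot_apply F L ((absoluteGaloisGroup.toAlgEquiv F).symm g) x
    rw [h x hx] at this
    exact this.symm
  · intro h x hx
    apply (absEmbedding F L).injective
    change absEmbedding F L (absGaloisQuot F L _ x) = absEmbedding F L x
    rw [absEmbedding_absGaloisQuot_apply]
    exact h _ ⟨x, hx, rfl⟩

/-- **The section `s : Gal(L/F) ↪ Gal(L·F_n/F)` and its fixed fields.**  `κ` a `ℤ_p`-extension of the number field `F`, `L/F`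
finite Galois with `κ ∘ res` onto, `e = absEmbedding F L`, `L_n = e(L) ⊔ F_n ⊆ F̄`.  There is an injective group homomorphism
`s : Gal(L/F) → Gal(L_n/F)` such that for every `H ≤ Gal(L/F)`:
`(L_n)^{s(H)} = e(L^H) ⊔ F_n` (`IntermediateField.lift`, as subfields of `F̄`), and consequently
`#Cl(𝓞 (L_n)^{s(H)}) = #Cl(𝓞 (κ|_{L^H})_n)` for any surjectivity witness of `κ|_{L^H}`.  (`s` = restriction to `L_n` of a lift in
`κ⁻¹(pⁿℤ_p) ≤ Γ_F`; `Gal(L_n/F) = s(Gal(L/F)) × Gal(L_n/e(L))`.) [cite: Washington1997, §13.1]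
[cite: MilneFT2022, Ch. 3 (fundamental theorem), Ch. 7 (absolute Galois group)] -/
theorem exists_section_fixedField_map_eq (κ : ZpExtension F p) (L : Type) [Field L] [NumberField L] [Algebra F L]
    [IsGalois F L] (hL : Function.Surjective (κ.toContinuousMonoidHom.comp (absGaloisRestrict F L))) (n : ℕ) :
    ∃ s : (L ≃ₐ[F] L) →*
        (↥((absEmbedding F L).fieldRange ⊔ κ.layer n) ≃ₐ[F] ↥((absEmbedding F L).fieldRange ⊔ κ.layer n)),
      Function.Injective s ∧
      (∀ H : Subgroup (L ≃ₐ[F] L), IntermediateField.lift (fixedField (H.map s)) =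
        IntermediateField.map (absEmbedding F L) (fixedField H) ⊔ κ.layer n) ∧
      (∀ (H : Subgroup (L ≃ₐ[F] L))
        (hH : Function.Surjective (κ.toContinuousMonoidHom.comp (absGaloisRestrict F ↥(fixedField H)))),
        Nat.card (ClassGroup (𝓞 ↥(fixedField (H.map s)))) =
          Nat.card (ClassGroup (𝓞 ↥((κ.restrict ↥(fixedField H) hH).layer n)))) := by
  classical
  haveI : FiniteDimensional F L := Module.Finite.of_restrictScalars_finite ℚ F L
  haveI : IsGalois F (AlgebraicClosure F) := IsAlgClosure.isGalois F _
  set e : L →ₐ[F] AlgebraicClosure F := absEmbedding F L with he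
  set Ln : IntermediateField F (AlgebraicClosure F) := e.fieldRange ⊔ κ.layer n with hLn
  haveI : IsGalois F ↥Ln := isGalois_fieldRange_sup_layer κ L e n
  haveI : FiniteDimensional F ↥Ln := finiteDimensional_fieldRange_sup_layer κ L e n
  set q : absoluteGaloisGroup F →* (L ≃ₐ[F] L) := absGaloisQuot F L with hq
  set rn : absoluteGaloisGroup F →* (↥Ln ≃ₐ[F] ↥Ln) :=
    (AlgEquiv.restrictNormalHom ↥Ln).comp (absoluteGaloisGroup.toAlgEquiv F).toMonoidHom with hrn
  have hrange : (absGaloisRestrict F L).range = (e.fieldRange.fixingSubgroup : Subgroup (absoluteGaloisGroup F)) :=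
    range_absGaloisRestrict_eq_fixingSubgroup_absEmbedding F L
  have hKn : (κ.layer n).fixingSubgroup = (κ.layerSubgroup n).map (absoluteGaloisGroup.toAlgEquiv F).toMonoidHom :=
    κ.fixingSubgroup_layer n
  -- `κ⁻¹(pⁿℤ_p) → Gal(L/F)` is onto
  have hlift : ∀ g : L ≃ₐ[F] L, ∃ σ ∈ κ.layerSubgroup n, q σ = g := by
    intro g
    obtain ⟨σ₀, hσ₀⟩ := absGaloisQuot_surjective F L g
    obtain ⟨τ, hτ⟩ := hL (κ σ₀)
    have hτ' : κ (absGaloisRestrict F L τ) = κ σ₀ := hτ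
    refine ⟨σ₀ * (absGaloisRestrict F L τ)⁻¹, ?_, ?_⟩
    · rw [mem_layerSubgroup, map_mul, map_inv, hτ', mul_inv_cancel, toAdd_one]
      exact dvd_zero _
    · rw [map_mul, map_inv, hσ₀, hq, absGaloisQuot_absGaloisRestrict, inv_one, mul_one]
  -- same kernel on `κ⁻¹(pⁿℤ_p)`
  have hker : ∀ σ ∈ κ.layerSubgroup n, q σ = 1 ↔ rn σ = 1 := by
    intro σ hσ
    rw [hq, absGaloisQuot_eq_one_iff, hrange]
    have h2 : rn σ = 1 ↔ absoluteGaloisGroup.toAlgEquiv F σ ∈ Ln.fixingSubgroup := by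
      rw [← IntermediateField.restrictNormalHom_ker, MonoidHom.mem_ker]
      rfl
    rw [h2, hLn, IntermediateField.fixingSubgroup_sup, Subgroup.mem_inf, hKn]
    exact ⟨fun h1 => ⟨h1, Subgroup.mem_map_of_mem _ hσ⟩, fun h1 => h1.1⟩
  obtain ⟨s, hs_inj, hs⟩ := exists_monoidHom_comp_eq' (κ.layerSubgroup n) q rn hlift hker
  -- the fixed fields of `s(H)`
  have hfix : ∀ H : Subgroup (L ≃ₐ[F] L), IntermediateField.lift (fixedField (H.map s)) =
      IntermediateField.map e (fixedField H) ⊔ κ.layer n := by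
    intro H
    have hA : H.map s = (H.comap q ⊓ κ.layerSubgroup n).map rn := by
      ext g
      constructor
      · rintro ⟨h, hh, rfl⟩
        obtain ⟨σ, hσK, hσ⟩ := hlift h
        refine ⟨σ, Subgroup.mem_inf.mpr ⟨?_, hσK⟩, ?_⟩
        · rw [Subgroup.mem_comap, hσ]; exact hh
        · rw [← hs σ hσK, hσ]
      · rintro ⟨σ, hσ, rfl⟩
        obtain ⟨hσH, hσK⟩ := Subgroup.mem_inf.mp hσ
        exact ⟨q σ, hσH, hs σ hσK⟩
    set S : Subgroup (AlgebraicClosure F ≃ₐ[F] AlgebraicClosure F) :=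
      (H.comap q ⊓ κ.layerSubgroup n).map (absoluteGaloisGroup.toAlgEquiv F).toMonoidHom with hS
    have hSmap : S.map (AlgEquiv.restrictNormalHom ↥Ln) = H.map s := by
      rw [hA, hS, Subgroup.map_map]
    have hSfix : fixedField S = IntermediateField.map e (fixedField H) ⊔ κ.layer n := by
      rw [hS, Subgroup.map_inf_eq _ _ _ (fun _ _ h => (absoluteGaloisGroup.toAlgEquiv F).injective h),
        map_comap_absGaloisQuot_eq_fixingSubgroup' L H, ← hKn, ← IntermediateField.fixingSubgroup_sup,
        InfiniteGalois.fixedField_fixingSubgroup]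
    have hle : IntermediateField.map e (fixedField H) ⊔ κ.layer n ≤ Ln := by
      refine sup_le_sup_right ?_ _
      rw [AlgHom.fieldRange_eq_map]
      exact IntermediateField.map_mono e le_top
    rw [← hSmap, ← InfiniteGalois.restrict_fixedField S Ln, hSfix]
    exact inf_eq_left.mpr hle
  refine ⟨s, hs_inj, hfix, fun H hH => ?_⟩
  have e₁ : ↥(fixedField (H.map s)) ≃ₐ[F] ↥(IntermediateField.map e (fixedField H) ⊔ κ.layer n) :=
    (IntermediateField.liftAlgEquiv (fixedField (H.map s))).trans (IntermediateField.equivOfEq (hfix H))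
  have h2 := natCard_classGroup_layer_restrict_eq κ ↥(fixedField H) hH (e.comp (fixedField H).val) n
  rw [IntermediateField.fieldRange_comp_val] at h2
  rw [h2]
  exact Nat.card_congr (ClassGroup.mulEquiv (NumberField.RingOfIntegers.mapRingEquiv e₁.toRingEquiv)).toEquiv

end Literature.NumberTheory.IwasawaTheory

end
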